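import Mathlib
import HarnessLib
import Summits.Ventures.LatticeQCDFlow.Scoring.RegenerativeCLT
import Summits.Ventures.LatticeQCDFlow.Scoring.IndepMHRegenerativeSigma

/-!
# Consequences of the regenerative CLT: coverage probabilities of the `√R`-scaled error converge
# to Gaussian probabilities (portmanteau), and the independence-Metropolis instance

HONEST FRAMING: exact (Metropolis-corrected) sampling algorithms for lattice gauge theory;
figures of merit are autocorrelation/cost numbers at stated couplings and volumes; no
continuum-physics claim.

Venture `LatticeQCDFlow` (cell pub-lqcd), topic `Scoring`; FANOUT row 8 (`s0-cpn-nemc`, GEN-18).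
NEW WORK of the cell, not a published result; no definition is introduced.  Notation of
`Scoring/RegenerativeCLT.lean` (`Â_R` the tour estimator of `R` tours from ANY initial law,
`c = π(f)`, `e = ε.toReal`, `σ²_f` the Green–Kubo asymptotic variance).  (i) THE STATEMENT A USER
READS OFF: for every `r > 0`, `P̂(|√R (Â_R − c)| ≤ r) → N(0, e σ²_f)([−r, r])` as `R → ∞` — the
regenerative CLT pushed through the portmanteau theorem
(`MeasureTheory.ProbabilityMeasure.tendsto_measure_of_null_frontier_of_tendsto'`; the two-point
frontier `{−r, r}` is null for the Gaussian, and for the point mass at `0` when `σ²_f = 0`).  So the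
nominal coverage of the interval `Â_R ± r/√R` is asymptotically EXACT, not merely a bound.
(ii) THE INDEPENDENCE-METROPOLIS INSTANCE: for `q = ρ·π` with `ρ x ≤ e^{M} ρ y`, every split kernel
of `(indepMH q (1/ρ), π, e^{−M})` — in particular the coin-augmented IMH step of
`Scoring/IndepMHRetrospectiveCoins.lean` — has `√R (Â_R − π f) ⇒ N(0, e^{−M} σ²_f)` from any start.
Printed counterpart NAMED ONLY: Mykland–Tierney–Yu 1995 §3–4; Hobert–Jones–Presnell–Rosenthal 2002
Thm 2 — nothing is cited as a fact.

## Content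

* **`regenerative_estimator_coverage`** — `r > 0`:
  `Tendsto (fun R => P̂.real {|√R (Â_R − c)| ≤ r}) atTop (𝓝 ((gaussianReal 0 (e σ²_f)).real [−r, r]))`;
* **`indepMH_regenerative_clt`** — the CLT for independence Metropolis with log-weight
  oscillation `≤ M`, at `e = e^{−M}`.

NOT CLAIMED: a rate of convergence of the coverage (Berry–Esseen); studentised intervals (the
plug-in variance in place of `σ²_f`); any `ε`, `M` of a concrete sampler.
-/

noncomputable section

namespace Summit.Ventures.LatticeQCDFlow.Scoring

open MeasureTheory ProbabilityTheory Filter Finset Preorder Literature.Probability.MarkovChains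
open Summit.Ventures.LatticeQCDFlow.Exactness
open scoped ENNReal Topology

section Coverage

variable {Ω : Type*} [MeasurableSpace Ω]
  {κ : Kernel Ω Ω} [IsMarkovKernel κ] {ν : Measure Ω} [IsProbabilityMeasure ν] {ε : ℝ≥0∞}
  {hmin : ∀ x {B : Set Ω}, MeasurableSet B → ε * ν B ≤ κ x B}
  (κs : Kernel (Ω × Bool) (Ω × Bool)) [IsMarkovKernel κs]
  (μs : Measure (Ω × Bool)) [IsProbabilityMeasure μs]

/-- **COVERAGE PROBABILITIES CONVERGE TO GAUSSIAN PROBABILITIES.**  `π` invariant,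
`κ(x, ·) ≥ ε ν` with `0 < ε < 1`, `|f| ≤ C` measurable, any initial law, `r > 0`:
`P̂(|√R (Â_R − π f)| ≤ r) → (gaussianReal 0 (e σ²_f)) [−r, r]` as `R → ∞`. -/
theorem regenerative_estimator_coverage {π : Measure Ω} [IsProbabilityMeasure π]
    (hπ : Kernel.Invariant κ π) (hε0 : 0 < ε) (hε : ε < 1)
    (hκs : ∀ p, κs p = (ε • ν).map (fun y : Ω => (y, true))
      + ((1 - ε) • Doeblin.residualKernel κ ν ε hmin p.1).map (fun y : Ω => (y, false)))
    {f : Ω → ℝ} (hf : Measurable f) {C : ℝ} (hC : ∀ x, |f x| ≤ C) {r : ℝ} (hr : 0 < r) :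
    Tendsto (fun R : ℕ => (Kernel.trajMeasure (X := fun _ : ℕ => Ω × Bool) μs
        (fun m : ℕ => κs.comap (fun h : (i : ↥(Finset.Iic m)) → Ω × Bool =>
          h ⟨m, Finset.mem_Iic.2 le_rfl⟩) (measurable_pi_apply _))).real
      {x | |Real.sqrt R * ((∑ i ∈ Finset.range R, ∑' u, (if (∑ s ∈ Finset.range u,
            (if (x (s + 1)).2 then (1 : ℕ) else 0)) = i + 1 then (1 : ℝ) else 0) * f (x u).1)
          / (∑ i ∈ Finset.range R, ∑' u, (if (∑ s ∈ Finset.range u,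
            (if (x (s + 1)).2 then (1 : ℕ) else 0)) = i + 1 then (1 : ℝ) else 0))
          - ∫ z, f z ∂π)| ≤ r})
      atTop (𝓝 ((gaussianReal 0 (ε.toReal * ((∫ y, (f y - ∫ z, f z ∂π) ^ 2 ∂π)
        + 2 * ∑' k, ∫ y, (f y - ∫ z, f z ∂π)
          * (kop κ)^[k + 1] (fun y => f y - ∫ z, f z ∂π) y ∂π)).toNNReal).real (Set.Icc (-r) r))) := by
  haveI hPI : IsProbabilityMeasure (Kernel.trajMeasure (X := fun _ : ℕ => Ω × Bool) μs
      (fun m : ℕ => κs.comap (fun h : (i : ↥(Finset.Iic m)) → Ω × Bool =>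
        h ⟨m, Finset.mem_Iic.2 le_rfl⟩) (measurable_pi_apply _))) := inferInstance
  set θ := (ε.toReal * ((∫ y, (f y - ∫ z, f z ∂π) ^ 2 ∂π)
        + 2 * ∑' k, ∫ y, (f y - ∫ z, f z ∂π)
          * (kop κ)^[k + 1] (fun y => f y - ∫ z, f z ∂π) y ∂π)).toNNReal with hθ
  -- the CLT with the identity of `ℝ` as the limit variable under the Gaussian law itself
  have hY : HasLaw (fun a : ℝ => a) (gaussianReal 0 θ) (gaussianReal 0 θ) :=
    ⟨aemeasurable_id', Measure.map_id'⟩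
  have hclt := regenerative_estimator_clt κs μs (κ := κ) (ν := ν) (hmin := hmin) hπ hε0 hε hκs hf hC hY
  -- the frontier `{−r, r}` of `[−r, r]` is null for the limit law
  have hE : ((gaussianReal 0 θ).map (fun a : ℝ => a)) (frontier (Set.Icc (-r) r)) = 0 := by
    rw [Measure.map_id', frontier_Icc (by linarith)]
    by_cases hθ0 : θ = 0
    · rw [hθ0, gaussianReal_zero_var, Measure.dirac_apply' _ (by measurability)]
      simp [Set.indicator, hr.ne', hr.ne]
    · haveI := nullSingletonClass_gaussianReal (μ := 0) hθ0
      exact (Set.toFinite _).measure_zero _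
  have key := ProbabilityMeasure.tendsto_measure_of_null_frontier_of_tendsto' hclt.tendsto hE
  -- unpack: `(P̂.map G_R) [−r, r] = P̂ {|G_R| ≤ r}`
  have hset : ∀ R : ℕ, ((Kernel.trajMeasure (X := fun _ : ℕ => Ω × Bool) μs
      (fun m : ℕ => κs.comap (fun h : (i : ↥(Finset.Iic m)) → Ω × Bool =>
        h ⟨m, Finset.mem_Iic.2 le_rfl⟩) (measurable_pi_apply _))).map
        (fun x : ℕ → Ω × Bool => Real.sqrt R
        * ((∑ i ∈ Finset.range R, ∑' u, (if (∑ s ∈ Finset.range u,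
            (if (x (s + 1)).2 then (1 : ℕ) else 0)) = i + 1 then (1 : ℝ) else 0) * f (x u).1)
          / (∑ i ∈ Finset.range R, ∑' u, (if (∑ s ∈ Finset.range u,
            (if (x (s + 1)).2 then (1 : ℕ) else 0)) = i + 1 then (1 : ℝ) else 0))
          - ∫ z, f z ∂π))) (Set.Icc (-r) r)
      = (Kernel.trajMeasure (X := fun _ : ℕ => Ω × Bool) μs
          (fun m : ℕ => κs.comap (fun h : (i : ↥(Finset.Iic m)) → Ω × Bool =>
            h ⟨m, Finset.mem_Iic.2 le_rfl⟩) (measurable_pi_apply _)))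
        {x | |Real.sqrt R * ((∑ i ∈ Finset.range R, ∑' u, (if (∑ s ∈ Finset.range u,
            (if (x (s + 1)).2 then (1 : ℕ) else 0)) = i + 1 then (1 : ℝ) else 0) * f (x u).1)
          / (∑ i ∈ Finset.range R, ∑' u, (if (∑ s ∈ Finset.range u,
            (if (x (s + 1)).2 then (1 : ℕ) else 0)) = i + 1 then (1 : ℝ) else 0))
          - ∫ z, f z ∂π)| ≤ r} := by
    intro R
    rw [Measure.map_apply_of_aemeasurable (hclt.forall_aemeasurable R) measurableSet_Icc]
    congr 1
    ext x
    simp only [Set.mem_preimage, Set.mem_Icc, Set.mem_setOf_eq, abs_le]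
  have key' := (ENNReal.tendsto_toReal (measure_ne_top _ (Set.Icc (-r) r))).comp key
  simp only [ProbabilityMeasure.coe_mk, Function.comp_def, hset, Measure.map_id'] at key'
  simp only [measureReal_def]
  exact key'

end Coverage

/-! ### The independence-Metropolis instance -/

section IndepMH

variable {Ω : Type*} [MeasurableSpace Ω]

/-- **THE REGENERATIVE CLT FOR AN INDEPENDENCE METROPOLIS SAMPLER with log-weight oscillation
`≤ M`**: `q = ρ·π`, `ρ > 0` measurable, `ρ x ≤ e^{M} ρ y`; `κ̂` any split kernel of
`(indepMH q (1/ρ), π, e^{−M})`, any initial law, `|f| ≤ C` measurable.  For any `Y` with law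
`N(0, e^{−M} σ²_f)`: `√R (Â_R − π f) ⇒ Y`. -/
theorem indepMH_regenerative_clt {π q : Measure Ω} [IsProbabilityMeasure π]
    [IsProbabilityMeasure q] {ρ : Ω → ℝ} (hρm : Measurable ρ) (hρ0 : ∀ x, 0 < ρ x)
    (hq : q = π.withDensity fun x => ENNReal.ofReal (ρ x)) {M : ℝ} (hM0 : 0 < M)
    (hM : ∀ x y, ρ x ≤ Real.exp M * ρ y)
    (κs : Kernel (Ω × Bool) (Ω × Bool)) [IsMarkovKernel κs]
    (hκs : haveI : Fact (Measurable fun x => (ρ x)⁻¹) := ⟨hρm.inv⟩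
      ∀ p, κs p = (ENNReal.ofReal (Real.exp (-M)) • π).map (fun y : Ω => (y, true))
        + ((1 - ENNReal.ofReal (Real.exp (-M))) • Doeblin.residualKernel
            (indepMH q fun x => (ρ x)⁻¹) π (ENNReal.ofReal (Real.exp (-M)))
            (fun x _ hB => (indepMH_exact_doeblin_of_density_ratio hρm hρ0 hq hM).2.2 x hB) p.1).map
          (fun y : Ω => (y, false)))
    (μs : Measure (Ω × Bool)) [IsProbabilityMeasure μs]
    {f : Ω → ℝ} (hf : Measurable f) {C : ℝ} (hC : ∀ x, |f x| ≤ C)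
    {Ω' : Type*} [MeasurableSpace Ω'] {P' : Measure Ω'} [IsProbabilityMeasure P'] {Y : Ω' → ℝ}
    (hY : haveI : Fact (Measurable fun x => (ρ x)⁻¹) := ⟨hρm.inv⟩
      HasLaw Y (gaussianReal 0 (Real.exp (-M) * ((∫ y, (f y - ∫ z, f z ∂π) ^ 2 ∂π)
        + 2 * ∑' k, ∫ y, (f y - ∫ z, f z ∂π)
          * (kop (indepMH q fun x => (ρ x)⁻¹))^[k + 1] (fun y => f y - ∫ z, f z ∂π) y ∂π)).toNNReal)
        P')
    [IsProbabilityMeasure (Kernel.trajMeasure (X := fun _ : ℕ => Ω × Bool) μs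
      (fun m : ℕ => κs.comap (fun h : (i : ↥(Finset.Iic m)) → Ω × Bool =>
        h ⟨m, Finset.mem_Iic.2 le_rfl⟩) (measurable_pi_apply _)))] :
    TendstoInDistribution (fun (R : ℕ) (x : ℕ → Ω × Bool) =>
        Real.sqrt R * ((∑ i ∈ Finset.range R, ∑' u, (if (∑ s ∈ Finset.range u,
            (if (x (s + 1)).2 then (1 : ℕ) else 0)) = i + 1 then (1 : ℝ) else 0) * f (x u).1)
          / (∑ i ∈ Finset.range R, ∑' u, (if (∑ s ∈ Finset.range u,
            (if (x (s + 1)).2 then (1 : ℕ) else 0)) = i + 1 then (1 : ℝ) else 0))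
          - ∫ z, f z ∂π))
      atTop Y (fun _ => Kernel.trajMeasure (X := fun _ : ℕ => Ω × Bool) μs
        (fun m : ℕ => κs.comap (fun h : (i : ↥(Finset.Iic m)) → Ω × Bool =>
          h ⟨m, Finset.mem_Iic.2 le_rfl⟩) (measurable_pi_apply _))) P' := by
  haveI : Fact (Measurable fun x => (ρ x)⁻¹) := ⟨hρm.inv⟩
  obtain ⟨hinv, -, hdoeb⟩ := indepMH_exact_doeblin_of_density_ratio hρm hρ0 hq hM
  have hε0 : 0 < ENNReal.ofReal (Real.exp (-M)) := ENNReal.ofReal_pos.2 (Real.exp_pos _)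
  have hε1 : ENNReal.ofReal (Real.exp (-M)) < 1 := by
    rw [ENNReal.ofReal_lt_one]
    exact Real.exp_lt_one_iff.2 (by linarith)
  have hr : (ENNReal.ofReal (Real.exp (-M))).toReal = Real.exp (-M) :=
    ENNReal.toReal_ofReal (Real.exp_pos _).le
  have hY' := hY
  rw [← hr] at hY'
  exact regenerative_estimator_clt κs μs (κ := indepMH q fun x => (ρ x)⁻¹) (ν := π)
    (hmin := fun x _ hB => hdoeb x hB) hinv hε0 hε1 hκs hf hC hY'

end IndepMH

end Summit.Ventures.LatticeQCDFlow.Scoring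

end
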